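/-
Copyright (c) 2026. All rights reserved.
Released under Apache 2.0 license as described in the file LICENSE.
Authors: HodgeCM publication cell (pub-hodgecm), floor-0 programme P4 (engine E-2), prover `A-p12`.
-/
import Literature.NumberTheory.Weil1964.AdelicMetaplecticRationalLiftIsometric
import HarnessLib

/-!
# The `L²` modulus of implementers over a compact set is bounded away from `0` and `∞`

Topic `NumberTheory/Weil1964`; namespace `Literature.NumberTheory.Weil1964`.  KERNEL MATHEMATICS ONLY (theorems over tree
declarations; no definition, no named fact, no proof hole).  In the boundedness step of the Siegel–Weil formula ([Weil1965] n° 47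
Lemme 20, n° 50 proof of Thm. 4) the compact part `k` of the reduction `b = γ⁻¹ b' k` is implemented in the metaplectic group of
record `Mp_ψ(W_𝔸)ᶜᵒⁿᵗ = adelicMpCont` by `q_k := u · s(k) · u⁻¹` for a homomorphic section `s` (a compatible splitting, conjugated into
the frame by a fixed `u`); the reduction lemma ★ `Weil1964.exists_borelBound` (and its instance ★ `E2SWBorelBound.exists_borelBound_of_lemma20`,
hypothesis `hIMPL`) needs the moduli `L(q_k)` (★ `adelicMpCont.l2Scaling`, [Weil1964] Chap. I n° 13) bounded below by some `c₁ > 0`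
uniformly for `k` in the compact `C`.  Since `L` is multiplicative (conjugation-invariant) and CONTINUOUS along every coefficient-continuous
homomorphism (★ `adelicMpCont.continuous_l2Scaling_comp_hom`, Steinhaus–Weil), this is compactness:

* `adelicMpCont.l2Scaling_conj` — `L(u · q · u⁻¹) = L(q)`;
* `adelicMpCont.exists_pos_le_l2Scaling_comp_of_isCompact` — `∃ c₁ c₂, 0 < c₁ ∧ ∀ k ∈ C, c₁ ≤ L(s k) ≤ c₂`;
* `adelicMpCont.exists_pos_le_l2Scaling_conj_comp_of_isCompact` — the same for `u · s(k) · u⁻¹` (the `hIMPL` modulus conjunct);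
* `adelicMpCont.l2Scaling_eq_one_of_omega_eq_chirpLM` — the frame unipotents `q` of the same step act by a second-degree
  character, `ω(q) = t(S)`, hence `L(q) = 1` (the modulus conjunct of the unipotent letter `hLN`).
Cell `hodgecm-mathlib`, floor-0 line P4, engine E-2, crux H413, sheet `SW2c-BOUND-ASSEMBLY.v1` row (IMPL).

References: [Weil1964] A. Weil, Acta Math. 111 (1964), Chap. I n° 13 p. 160 (the modulus of a metaplectic operator);
[Weil1965] A. Weil, Acta Math. 113 (1965), n° 47 Lemma 20 and n° 50 (the compact part of the reduction); [HewittRoss1979]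
E. Hewitt, K. A. Ross, *Abstract Harmonic Analysis I*, Thm. 22.18 (measurable homomorphisms are continuous).
-/

set_option autoImplicit false

noncomputable section

namespace Literature.NumberTheory.Weil1964

open Literature.NumberTheory.Automorphic Literature.RepresentationTheory.HeisenbergGroup
open NumberField _root_.MeasureTheory
open scoped ENNReal

variable (F : Type) [Field F] [NumberField F] {n : ℕ}
variable (T : Matrix (Fin n) (Fin n) (AdeleRing (𝓞 F) F)) (hT : IsUnit T.det)
variable [MeasurableSpace (AdeleRing (𝓞 F) F)] [BorelSpace (AdeleRing (𝓞 F) F)]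
  (ν : Measure (Fin n → AdeleRing (𝓞 F) F)) [ν.IsAddHaarMeasure]

/-- **`L(u · q · u⁻¹) = L(q)`**: the `L²` modulus is a homomorphism to a commutative group, hence conjugation-invariant.
[cite: Weil1964, Chap. I n° 13 p. 160] -/
theorem adelicMpCont.l2Scaling_conj (u q : adelicMpCont F (Fin n) T) :
    adelicMpCont.l2Scaling F T hT ν (u * q * u⁻¹) = adelicMpCont.l2Scaling F T hT ν q := by
  rw [adelicMpCont.l2Scaling_mul, adelicMpCont.l2Scaling_mul, adelicMpCont.l2Scaling_inv, mul_right_comm,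
    ENNReal.mul_inv_cancel (adelicMpCont.l2Scaling_ne_zero F T hT ν u) (adelicMpCont.l2Scaling_ne_top F T hT ν u), one_mul]

section Hom

variable {G : Type*} [Group G] [TopologicalSpace G] [IsTopologicalGroup G] [LocallyCompactSpace G]
  [SecondCountableTopology G] [TopologicalSpace.MetrizableSpace G] [MeasurableSpace G] [BorelSpace G]
  (s : G →* adelicMpCont F (Fin n) T) (hs : Continuous fun g => (s g : adelicMp F (Fin n) T))

include hs in
/-- **THE MODULI OF IMPLEMENTERS OVER A COMPACT SET ARE BOUNDED AWAY FROM `0` AND `∞`**: for a coefficient-continuous homomorphism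
`s : G →* Mp_ψ(W_𝔸)ᶜᵒⁿᵗ` and a compact `C ⊆ G` there are `0 < c₁`, `c₂` with `c₁ ≤ L(s k) ≤ c₂` for `k ∈ C` (continuity of `L ∘ s`,
★ `continuous_l2Scaling_comp_hom`, and positivity of `L`). [cite: Weil1965, n° 47 Lemma 20 and n° 50] [cite: Weil1964, Chap. I n° 13 p. 160] -/
theorem adelicMpCont.exists_pos_le_l2Scaling_comp_of_isCompact {C : Set G} (hC : IsCompact C) :
    ∃ c₁ c₂ : ℝ, 0 < c₁ ∧ ∀ k ∈ C, c₁ ≤ (adelicMpCont.l2Scaling F T hT ν (s k)).toReal ∧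
      (adelicMpCont.l2Scaling F T hT ν (s k)).toReal ≤ c₂ := by
  have hcont : Continuous fun g => (adelicMpCont.l2Scaling F T hT ν (s g)).toReal :=
    adelicMpCont.continuous_l2Scaling_comp_hom F T hT ν s hs
  have hpos : ∀ g, 0 < (adelicMpCont.l2Scaling F T hT ν (s g)).toReal := fun g =>
    ENNReal.toReal_pos (adelicMpCont.l2Scaling_ne_zero F T hT ν (s g)) (adelicMpCont.l2Scaling_ne_top F T hT ν (s g))
  -- (`rcases`/`obtain` on non-variable terms and `rw` on the goal run `isTypeCorrect` on the whole target, which times out on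
  -- these operator-valued instances; hence the `have`-then-`rcases` phrasing.)
  by_cases hCne : C.Nonempty
  · have h₁ := hC.exists_isMinOn hCne hcont.continuousOn
    have h₂ := hC.exists_isMaxOn hCne hcont.continuousOn
    rcases h₁ with ⟨k₁, -, hmin⟩
    rcases h₂ with ⟨k₂, -, hmax⟩
    exact ⟨_, _, hpos k₁, fun k hk => ⟨isMinOn_iff.mp hmin k hk, isMaxOn_iff.mp hmax k hk⟩⟩
  · exact ⟨1, 1, one_pos, fun k hk => absurd ⟨k, hk⟩ hCne⟩

include hs in
/-- **THE `hIMPL` MODULUS CONJUNCT**: for the conjugated implementers `q_k := u · s(k) · u⁻¹` of the boundedness step (the compact part of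
Weil's reduction, read in the frame through a fixed `u ∈ Mp_ψ(W_𝔸)ᶜᵒⁿᵗ`) there are `0 < c₁`, `c₂` with `c₁ ≤ L(q_k) ≤ c₂` on the compact `C`.
[cite: Weil1965, n° 47 Lemma 20 and n° 50] [cite: Weil1964, Chap. I n° 13 p. 160] -/
theorem adelicMpCont.exists_pos_le_l2Scaling_conj_comp_of_isCompact (u : adelicMpCont F (Fin n) T) {C : Set G} (hC : IsCompact C) :
    ∃ c₁ c₂ : ℝ, 0 < c₁ ∧ ∀ k ∈ C, c₁ ≤ (adelicMpCont.l2Scaling F T hT ν (u * s k * u⁻¹)).toReal ∧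
      (adelicMpCont.l2Scaling F T hT ν (u * s k * u⁻¹)).toReal ≤ c₂ := by
  have h₀ := adelicMpCont.exists_pos_le_l2Scaling_comp_of_isCompact F T hT ν s hs hC
  rcases h₀ with ⟨c₁, c₂, hc₁, h⟩
  refine ⟨c₁, c₂, hc₁, fun k hk => ?_⟩
  have e := congrArg ENNReal.toReal (adelicMpCont.l2Scaling_conj F T hT ν u (s k))
  exact ⟨(h k hk).1.trans_eq e.symm, e.trans_le (h k hk).2⟩

end Hom

/-- **`ω(q) = t(S)` ⇒ `L(q) = 1`**: an element of `Mp_ψ(W_𝔸)ᶜᵒⁿᵗ` acting by a second-degree character (the frame unipotents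
`u₀ · 𝐫₀ᶜᵒⁿᵗ(P_N) · u₀⁻¹` of the boundedness step, ★ `omega_conj_adelicSiegelLiftCont_of_unipShape`) has modulus `1`, the multiplier
`ψ(ᵗx S x)` being unimodular (★ `lintegral_enorm_sq_chirp`). [cite: Weil1964, Chap. I n° 13 p. 160] -/
theorem adelicMpCont.l2Scaling_eq_one_of_omega_eq_chirpLM (q : adelicMpCont F (Fin n) T)
    (S : Matrix (Fin n) (Fin n) (AdeleRing (𝓞 F) F))
    (hq : ∀ Φ : piSchwartzBruhat F (Fin n), adelicMpCont.omega F (Fin n) T q Φ = chirpLM F S Φ) :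
    adelicMpCont.l2Scaling F T hT ν q = 1 :=
  adelicMpCont.l2Scaling_eq_of_forall F T hT ν q fun Φ =>
    ((congrArg (fun Ψ : piSchwartzBruhat F (Fin n) =>
        ∫⁻ x, ‖((Ψ : piSchwartzBruhat F (Fin n)) : (Fin n → AdeleRing (𝓞 F) F) → ℂ) x‖ₑ ^ 2 ∂ν) (hq Φ)).trans
      (lintegral_enorm_sq_chirp F ν S _)).trans (one_mul _).symm

end Literature.NumberTheory.Weil1964
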